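import Mathlib
import HarnessLib
import Summits.Ventures.LatticeQCDFlow.Exactness.BestFisherAngle
import Summits.Ventures.LatticeQCDFlow.Exactness.CreutzSampler

/-!
# The engine's two small-parameter shortcuts: the substituted law is within a factor `e^{2κ}` of the exact one

HONEST FRAMING: exact (Metropolis-corrected) sampling algorithms for lattice gauge theory;
figures of merit are autocorrelation/cost numbers at stated couplings and volumes; no
continuum-physics claim.

Venture `LatticeQCDFlow` (cell pub-lqcd), topic `Exactness`, FANOUT row 9 (eng-latcore, the
engine `latflow.core`).  NEW WORK of the cell over Mathlib and row 9's `BestFisherAngle.lean`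
(`vonMisesLaw`, the `κ = 0` branch is the uniform angle) and `CreutzSampler.lean` /
`KennedyPendletonSampler.lean` (`a0Law`, the `bt = 0` loop).  Nothing is cited as a fact.

Two branches of the engine are NOT exact but deliberate small-parameter substitutions, listed as
NOT CLAIMED in the gen-11 files: `csrc/cpn_kernel.c` `rng_vonmises` returns a UNIFORM angle when
`κ < 1e−8` (exact law: von Mises `∝ e^{κ cos φ}`), and `csrc/latcore_template.c` `sample_a0` runs the
`bt = 0` Creutz loop (output `∝ √(1−t²)`) when `0 < bt ≤ 1e−12` (exact law `∝ √(1−t²) e^{bt·t}`).  This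
file quantifies both, in idealised real arithmetic, as two-sided domination of measures (hence of
every event's probability and of every non-negative expectation):

* `withDensity_exp_le_smul`, `le_smul_withDensity_exp` — tilting a measure by `e^{w}` with `|w| ≤ ε`
  a.e. changes it by at most the factor `e^{ε}` either way;
* **`normalize_tilt_le`**, **`normalize_le_tilt`** — after NORMALISATION the two probability laws
  dominate each other within the factor `e^{2ε}` (`unif ≤ e^{2ε} • tilted`, `tilted ≤ e^{2ε} • unif`);
* **`vonMises_branch_le`, `vonMises_branch_ge`** — the von Mises law at concentration `κ ≥ 0` and the
  uniform angle (`= vonMisesLaw 0`, the engine's branch) normalised: within `e^{2κ}`; for the engine's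
  threshold `κ < 10⁻⁸` the factor is `< e^{2·10⁻⁸}` (`vonMises_branch_factor`);
* **`a0_branch_le`, `a0_branch_ge`** — the SU(2) `a₀` law `∝ √(1−t²)e^{bt·t}` and the semicircle law
  (`bt = 0`, the engine's branch) normalised: within `e^{2bt}` (`|t| ≤ 1` on the support); for
  `bt ≤ 10⁻¹²` the factor is `≤ e^{2·10⁻¹²}`.

In total variation this is `≤ e^{2ε} − 1` (`≈ 2·10⁻⁸`, `2·10⁻¹²`); not restated.  NOT CLAIMED: that the
thresholds are optimal, floating point (where the shortcut exists to avoid `0/0` and overflow).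
-/

namespace Summit.Ventures.LatticeQCDFlow.Exactness

open MeasureTheory Measure Set Real
open scoped ENNReal

/-! ## §1 Tilting by `e^{w}`, `|w| ≤ ε` -/

section Tilt

variable {X : Type*} [MeasurableSpace X] {μ : Measure X} {w : X → ℝ} {ε : ℝ}

/-- `e^{w} · μ ≤ e^{ε} • μ` when `w ≤ ε` a.e. (in fact `|w| ≤ ε`). -/
theorem withDensity_exp_le_smul (hw : ∀ᵐ x ∂μ, |w x| ≤ ε) :
    μ.withDensity (fun x => ENNReal.ofReal (Real.exp (w x))) ≤ ENNReal.ofReal (Real.exp ε) • μ := by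
  refine Measure.le_iff.2 fun s hs => ?_
  rw [withDensity_apply _ hs, Measure.smul_apply, smul_eq_mul, ← setLIntegral_const]
  exact lintegral_mono_ae ((ae_restrict_of_ae hw).mono fun x hx =>
    ENNReal.ofReal_le_ofReal (Real.exp_le_exp.2 (abs_le.1 hx).2))

/-- `μ ≤ e^{ε} • (e^{w} · μ)` when `−ε ≤ w` a.e. (in fact `|w| ≤ ε`). -/
theorem le_smul_withDensity_exp (hwm : Measurable w) (hw : ∀ᵐ x ∂μ, |w x| ≤ ε) :
    μ ≤ ENNReal.ofReal (Real.exp ε) • μ.withDensity (fun x => ENNReal.ofReal (Real.exp (w x))) := by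
  have hm : Measurable fun x => ENNReal.ofReal (Real.exp (w x)) := (Real.measurable_exp.comp hwm).ennreal_ofReal
  refine Measure.le_iff.2 fun s hs => ?_
  rw [Measure.smul_apply, smul_eq_mul, withDensity_apply _ hs, ← lintegral_const_mul _ hm]
  calc μ s = ∫⁻ _ in s, 1 ∂μ := (setLIntegral_one s).symm
    _ ≤ ∫⁻ x in s, ENNReal.ofReal (Real.exp ε) * ENNReal.ofReal (Real.exp (w x)) ∂μ :=
        lintegral_mono_ae ((ae_restrict_of_ae hw).mono fun x hx => by
          rw [← ENNReal.ofReal_mul (Real.exp_pos ε).le, ← Real.exp_add, ← ENNReal.ofReal_one]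
          exact ENNReal.ofReal_le_ofReal (Real.one_le_exp (by linarith [(abs_le.1 hx).1])))

/-- Inverting a domination of total masses: `a ≤ c b` gives `b⁻¹ ≤ c a⁻¹` (`c ∉ {0, ∞}`). -/
theorem inv_le_mul_inv_of_le {a b c : ℝ≥0∞} (hc0 : c ≠ 0) (hctop : c ≠ ∞) (h : a ≤ c * b) : b⁻¹ ≤ c * a⁻¹ :=
  calc b⁻¹ = c * (c * b)⁻¹ := by
        rw [ENNReal.mul_inv (Or.inl hc0) (Or.inl hctop), ← mul_assoc, ENNReal.mul_inv_cancel hc0 hctop, one_mul]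
    _ ≤ c * a⁻¹ := mul_le_mul' le_rfl (ENNReal.inv_le_inv.2 h)

/-- **Normalised tilt, upper**: for a measure `μ` of non-zero mass and `|w| ≤ ε` a.e., the normalised
tilted law is at most `e^{2ε}` times the normalised law. -/
theorem normalize_tilt_le (hwm : Measurable w) (hw : ∀ᵐ x ∂μ, |w x| ≤ ε) :
    ((μ.withDensity fun x => ENNReal.ofReal (Real.exp (w x))) univ)⁻¹ •
        μ.withDensity (fun x => ENNReal.ofReal (Real.exp (w x))) ≤
      ENNReal.ofReal (Real.exp (2 * ε)) • ((μ univ)⁻¹ • μ) := by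
  have hc0 : ENNReal.ofReal (Real.exp ε) ≠ 0 := (ENNReal.ofReal_pos.2 (Real.exp_pos ε)).ne'
  have h1 := Measure.le_iff.1 (withDensity_exp_le_smul hw)
  have h2 := Measure.le_iff.1 (le_smul_withDensity_exp hwm hw) univ MeasurableSet.univ
  simp only [Measure.smul_apply, smul_eq_mul] at h1 h2
  have hinv := inv_le_mul_inv_of_le hc0 ENNReal.ofReal_ne_top h2
  refine Measure.le_iff.2 fun s hs => ?_
  simp only [Measure.smul_apply, smul_eq_mul]
  calc ((μ.withDensity fun x => ENNReal.ofReal (Real.exp (w x))) univ)⁻¹ *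
        (μ.withDensity fun x => ENNReal.ofReal (Real.exp (w x))) s ≤
      (ENNReal.ofReal (Real.exp ε) * (μ univ)⁻¹) * (ENNReal.ofReal (Real.exp ε) * μ s) := mul_le_mul' hinv (h1 s hs)
    _ = ENNReal.ofReal (Real.exp (2 * ε)) * ((μ univ)⁻¹ * μ s) := by
        rw [show 2 * ε = ε + ε by ring, Real.exp_add, ENNReal.ofReal_mul (Real.exp_pos ε).le]; ring

/-- **Normalised tilt, lower**: … and the normalised law is at most `e^{2ε}` times the normalised
tilted law. -/
theorem normalize_le_tilt (hwm : Measurable w) (hw : ∀ᵐ x ∂μ, |w x| ≤ ε) :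
    (μ univ)⁻¹ • μ ≤ ENNReal.ofReal (Real.exp (2 * ε)) •
      (((μ.withDensity fun x => ENNReal.ofReal (Real.exp (w x))) univ)⁻¹ •
        μ.withDensity (fun x => ENNReal.ofReal (Real.exp (w x)))) := by
  have hc0 : ENNReal.ofReal (Real.exp ε) ≠ 0 := (ENNReal.ofReal_pos.2 (Real.exp_pos ε)).ne'
  have h1 := Measure.le_iff.1 (withDensity_exp_le_smul hw) univ MeasurableSet.univ
  have h2 := Measure.le_iff.1 (le_smul_withDensity_exp hwm hw)
  simp only [Measure.smul_apply, smul_eq_mul] at h1 h2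
  have hinv := inv_le_mul_inv_of_le hc0 ENNReal.ofReal_ne_top h1
  refine Measure.le_iff.2 fun s hs => ?_
  simp only [Measure.smul_apply, smul_eq_mul]
  calc (μ univ)⁻¹ * μ s ≤ (ENNReal.ofReal (Real.exp ε) * ((μ.withDensity fun x => ENNReal.ofReal (Real.exp (w x))) univ)⁻¹) *
        (ENNReal.ofReal (Real.exp ε) * (μ.withDensity fun x => ENNReal.ofReal (Real.exp (w x))) s) :=
        mul_le_mul' hinv (h2 s hs)
    _ = ENNReal.ofReal (Real.exp (2 * ε)) * (((μ.withDensity fun x => ENNReal.ofReal (Real.exp (w x))) univ)⁻¹ *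
        (μ.withDensity fun x => ENNReal.ofReal (Real.exp (w x))) s) := by
        rw [show 2 * ε = ε + ε by ring, Real.exp_add, ENNReal.ofReal_mul (Real.exp_pos ε).le]; ring

end Tilt

/-! ## §2 The CP(N−1) link heat bath's `κ < 1e−8` branch (uniform angle instead of von Mises) -/

/-- The von Mises law is the uniform window `(−π, π)` (`= vonMisesLaw 0`) tilted by `e^{κ cos φ}`. -/
theorem vonMisesLaw_eq_tilt (κ : ℝ) :
    vonMisesLaw κ = (vonMisesLaw 0).withDensity fun φ => ENNReal.ofReal (Real.exp (κ * Real.cos φ)) := by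
  rw [vonMisesLaw, vonMisesLaw, show (fun φ : ℝ => ENNReal.ofReal (Real.exp (0 * Real.cos φ))) = 1 by
    funext φ; simp, withDensity_one]

/-- **The `κ`-branch, upper side**: the exact (normalised von Mises) law is at most `e^{2κ}` times the
uniform-angle law the engine substitutes (`κ ≥ 0`). -/
theorem vonMises_branch_le {κ : ℝ} (hκ : 0 ≤ κ) :
    (vonMisesLaw κ univ)⁻¹ • vonMisesLaw κ ≤ ENNReal.ofReal (Real.exp (2 * κ)) • ((vonMisesLaw 0 univ)⁻¹ • vonMisesLaw 0) := by
  rw [vonMisesLaw_eq_tilt κ]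
  refine normalize_tilt_le (by fun_prop) (ae_of_all _ fun φ => ?_)
  rw [abs_mul, abs_of_nonneg hκ]
  exact mul_le_of_le_one_right hκ (Real.abs_cos_le_one φ)

/-- **The `κ`-branch, lower side**: the uniform-angle law is at most `e^{2κ}` times the exact law. -/
theorem vonMises_branch_ge {κ : ℝ} (hκ : 0 ≤ κ) :
    (vonMisesLaw 0 univ)⁻¹ • vonMisesLaw 0 ≤ ENNReal.ofReal (Real.exp (2 * κ)) • ((vonMisesLaw κ univ)⁻¹ • vonMisesLaw κ) := by
  rw [vonMisesLaw_eq_tilt κ]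
  refine normalize_le_tilt (by fun_prop) (ae_of_all _ fun φ => ?_)
  rw [abs_mul, abs_of_nonneg hκ]
  exact mul_le_of_le_one_right hκ (Real.abs_cos_le_one φ)

/-- **The engine's threshold**: for `0 ≤ κ < 10⁻⁸` the domination factor is below `e^{2·10⁻⁸}`. -/
theorem vonMises_branch_factor {κ : ℝ} (hκ : κ < 1e-8) : Real.exp (2 * κ) < Real.exp (2e-8) :=
  Real.exp_lt_exp.2 (by norm_num at hκ ⊢; linarith)

/-! ## §3 The SU(2) heat bath's `0 < bt ≤ 1e−12` branch (semicircle law instead of `√(1−t²)e^{bt t}`) -/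

/-- A3's law at coupling `c` is the semicircle law (`c = 0`) tilted by `e^{ct}`. -/
theorem a0Law_eq_tilt (c : ℝ) :
    a0Law c = (a0Law 0).withDensity fun t => ENNReal.ofReal (Real.exp (c * t)) := by
  have hs : Measurable fun t : ℝ => ENNReal.ofReal (semicircleDensity t * Real.exp (0 * t)) := by
    unfold semicircleDensity; fun_prop
  rw [a0Law, a0Law, ← withDensity_mul _ hs (by fun_prop)]
  congr 1
  funext t
  rw [Pi.mul_apply, zero_mul, Real.exp_zero, mul_one, ← ENNReal.ofReal_mul (semicircleDensity_nonneg t)]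

/-- On the support of the semicircle law `|t| < 1`, so `|c t| ≤ |c|` almost everywhere. -/
theorem ae_a0Law_zero_abs_mul_le (c : ℝ) : ∀ᵐ t ∂(a0Law 0), |c * t| ≤ |c| := by
  have hs : Measurable fun t : ℝ => ENNReal.ofReal (semicircleDensity t * Real.exp (0 * t)) := by
    unfold semicircleDensity; fun_prop
  rw [a0Law, ae_withDensity_iff hs]
  refine ae_of_all _ fun t ht => ?_
  have h1 : |t| < 1 := by
    by_contra h
    exact ht (by rw [semicircleDensity_eq_zero_of_one_le_abs (not_lt.1 h), zero_mul, ENNReal.ofReal_zero])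
  rw [abs_mul]
  exact mul_le_of_le_one_right (abs_nonneg c) h1.le

/-- **The `bt`-branch, upper side**: the exact law `∝ √(1−t²)e^{bt·t}` (normalised) is at most `e^{2bt}`
times the semicircle law the engine substitutes (`bt ≥ 0`). -/
theorem a0_branch_le {bt : ℝ} (hbt : 0 ≤ bt) :
    (a0Law bt univ)⁻¹ • a0Law bt ≤ ENNReal.ofReal (Real.exp (2 * bt)) • ((a0Law 0 univ)⁻¹ • a0Law 0) := by
  rw [a0Law_eq_tilt bt]
  have h := normalize_tilt_le (ε := |bt|) (by fun_prop : Measurable fun t : ℝ => bt * t)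
    (ae_a0Law_zero_abs_mul_le bt)
  rwa [abs_of_nonneg hbt] at h

/-- **The `bt`-branch, lower side**: the semicircle law is at most `e^{2bt}` times the exact law. -/
theorem a0_branch_ge {bt : ℝ} (hbt : 0 ≤ bt) :
    (a0Law 0 univ)⁻¹ • a0Law 0 ≤ ENNReal.ofReal (Real.exp (2 * bt)) • ((a0Law bt univ)⁻¹ • a0Law bt) := by
  rw [a0Law_eq_tilt bt]
  have h := normalize_le_tilt (ε := |bt|) (by fun_prop : Measurable fun t : ℝ => bt * t)
    (ae_a0Law_zero_abs_mul_le bt)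
  rwa [abs_of_nonneg hbt] at h

/-- **The engine's threshold**: for `bt ≤ 10⁻¹²` the domination factor is at most `e^{2·10⁻¹²}`. -/
theorem a0_branch_factor {bt : ℝ} (hbt : bt ≤ 1e-12) : Real.exp (2 * bt) ≤ Real.exp (2e-12) :=
  Real.exp_le_exp.2 (by norm_num at hbt ⊢; linarith)

end Summit.Ventures.LatticeQCDFlow.Exactness
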